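import Literature.Analysis.FluidPDE.VorticitySupEnstrophyGronwallSharp
import Summits.NavierStokesRegularity.NavierStokesRegularity.Theorems.CertifiedBlowupCertifiedBlowupVorticityRateBlowupSlabExponent
import HarnessLib

/-!
# Certificate class `CertifiedBlowupVorticityRateBlowup` (stmt-NavierStokesRegularity-8639): THE SHARP FLOOR —
# `C_ω > √3/4` STRICTLY, crux #4 `CertifiedBlowupVorticityRateExclusion` PROVED FOR EVERY `C < √3/4`, and the modulation
# law with exponent `(2/√3)C_ω`

Theorems file landed `--supports stmt-NavierStokesRegularity-8639` (cell `ns-blowup`, GROUP B zone Z1 → the certificate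
crux; eleventh crux-side deposit of the zone-Z1 seat, the CLOSING file of lead letter (ls)). The ninth and tenth deposits
(`…SlabFloor`, `…SlabExponent`) run the floor / power-law / velocity-exponent chain under an enstrophy slab Grönwall with
coefficient `κ`: floor `C ≥ 1/(2κ)` (strict), exclusion below `1/(2κ)`, power law `(T − t)^{−κC}`, velocity
`(T − t)^{−(1+κC)/3}`. The Literature file `VorticitySupEnstrophyGronwallSharp` (the STRAIN form of RRS (12.11):
`ω·∇u·ω = ω·Sω`, `tr S = 0` ⇒ `|ξ·Sξ| ≤ √(2/3)|S|_F` (Chae 2005 Thm 2.2), `|S|²_F = |∇u|²_F − ½|ω|²`; slab Grönwall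
`∫|ω(t)|² ≤ ∫|ω(0)|²·exp((2/√3)ΩT'')`) supplies the coefficient `κ = 2/√3`, and `1/(2κ) = √3/4`:

* `slab_gronwall_sharp` — `(S_{2/√3})` holds for every classical unforced solution on `[0, T) × ℝ³`, `ν > 0`, in the
  Beale–Kato–Majda class on every `[0, T'']`, `T'' < T` (`integral_sq_norm_curl_le_mul_exp_sharp_of_norm_curl_le`,
  time-translated);
* `log_le_sharp_of_vorticityRate` — `log q ≤ (4/√3)C(q − 1)` for every `q > 1` under the rate on `[t₀, T)`;
* `vorticityRate_witness_const_ge_sqrt3_div_four` / **`vorticityRate_witness_const_gt_sqrt3_div_four`** — for every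
  witness of the certificate class and every admissible `C`: **`C > √3/4 ≈ 0.4330` STRICTLY** (was `1/4`, deposits 6/8);
* `vorticityRate_witness_frequently_gt_sharp` — `limsup_{t→T⁻} (T − t)‖ω(t)‖_∞ ≥ √3/4`;
* **`vorticityRateExclusion_below_sqrt3_div_four`** — THE KILL STATEMENT crux #4 `CertifiedBlowupVorticityRateExclusion`
  with `∀ C` replaced by `∀ C < √3/4`, verbatim otherwise: PROVED (the certificate class with constant `< √3/4` is EMPTY);
* `integral_sq_norm_curl_le_rpow_sharp` — `∫|ω(t)|² ≤ ∫|ω(t₀)|²((T − t₀)/(T − t))^{(2/√3)C}` for all `t ∈ [t₀, T)`;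
  `vorticityRate_witness_velocity_exponent_sharp` — `(T − t)^{1+(2/√3)C}‖u(t, x)‖³ ≤ K` on `[t₀, T) × ℝ³`.

READING (quantitative BKM, sharp form of this method): `∫‖ω‖_∞ ≥ (√3/4)log(1/(T − t)) − K`; ZONE-Z1 MODULATION LAW:
`γ_u ≤ (1 + (2/√3)C_ω)/3`, `λ_a ≳ (T − t)^{(1+(2/√3)C_ω)/3}`, `d ≲ (T − t)^{(1−(4/√3)C_ω)/3}`; K-AUDIT HOOK: a candidate
printing `‖u‖_∞ ∼ (T − t)^{−γ}` needs `C_ω ≥ (√3/2)(3γ − 1)` (`γ = 1` ⇒ `C_ω ≥ √3 ≈ 1.73`; `γ = 2/3` ⇒ `C_ω ≥ √3/2`).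
The constant `2/√3` is the endpoint of the enstrophy method (equality case: `ω` on the stretching axis of
`S ∝ diag(2, −1, −1)` with `|S|² = ½|ω|²`, `|ω| = Ω`); it is not claimed optimal for the crux. No new definitions, no
named-fact hypotheses, no `sorry`. WHAT THIS IS NOT: not a blow-up or regularity claim — a priori inequalities about a
HYPOTHETICAL witness of the certificate class; crux 8639 and (AX-L) untouched; crux 8640 proved only below `√3/4`.
Author: ns-blowup-profile-eng-1 g12, 2026-08-27.

## References
* D. Chae, Comm. Math. Phys. 263 (2005) 789–801, (2.4), (2.7), Thm 2.2. [Chae2005]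
* J. C. Robinson, J. L. Rodrigo, W. Sadowski, CUP 2016, Thm 12.3 (12.11)–(12.12). [RobinsonRodrigoSadowski2016]
* E. Miller, Arch. Ration. Mech. Anal. 235 (2020), Prop. 3.1. [Miller2019]
* J. Leray, Acta Math. 63 (1934), §20 (3.12). [Leray1934]
* G. Koch, N. Nadirashvili, G. Seregin, V. Šverák, Acta Math. 203 (2009), Thms 6.1–6.2. [KochNadirashviliSereginSverak2009]
-/

-- the summit and its single problem share the name (D-0017 nested layout)
set_option linter.dupNamespace false

noncomputable section

open MeasureTheory Set Function Filter Topology Metric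
open scoped ENNReal NNReal

namespace Summit.NavierStokesRegularity.NavierStokesRegularity.Theorems.CertifiedBlowupVorticityRateBlowup.SlabFloor

open Literature.Analysis.FluidPDE
open Summit.NavierStokesRegularity.NavierStokesRegularity.Theorems.CertifiedBlowupAxisymBlowup.CompactAmplification

variable {ν T : ℝ} {u : ℝ → EuclideanSpace ℝ (Fin 3) → EuclideanSpace ℝ (Fin 3)}
  {p : ℝ → EuclideanSpace ℝ (Fin 3) → ℝ}

/-- `1/(2 · (2/√3)) = √3/4`. [folklore] -/
theorem inv_two_mul_two_div_sqrt_three : (1 : ℝ) / (2 * (2 / Real.sqrt 3)) = Real.sqrt 3 / 4 := by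
  rw [show (2 : ℝ) * (2 / Real.sqrt 3) = 4 / Real.sqrt 3 by ring, one_div_div]

/-- `0 < 2/√3`. [folklore] -/
theorem two_div_sqrt_three_pos : (0 : ℝ) < 2 / Real.sqrt 3 :=
  div_pos two_pos (Real.sqrt_pos.2 (by norm_num))

/-! ### The strain instance: `κ = 2/√3` -/

/-- **`(S_{2/√3})` holds for classical solutions.** Let `(u, p)` be a classical unforced solution on `[0, T) × ℝ³`,
`ν > 0`, in the Beale–Kato–Majda class on every `[0, T'']`, `T'' < T`. Then for all `0 ≤ t₁ < t₂ < T` and `Ω` with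
`‖curl u(t, x)‖ ≤ Ω` on `[t₁, t₂] × ℝ³`: `∫|curl u(t₂)|² ≤ (∫|curl u(t₁)|²) · exp((2/√3)Ω(t₂ − t₁))` — the Literature
slab bound `integral_sq_norm_curl_le_mul_exp_sharp_of_norm_curl_le` for the translate `u(· + t₁)` on `[0, t₂ − t₁]`.
[cite: Chae2005, Thm 2.2; RobinsonRodrigoSadowski2016, Thm 12.3 (12.12); Miller2019, Prop. 3.1] -/
theorem slab_gronwall_sharp (hν : 0 < ν) (hcl : IsClassicalNSSolutionOn (Ico 0 T) ν 0 u p)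
    (hreg : ∀ T'' < T, HasBoundedSobolevNormsOn (Icc 0 T'') u) :
    ∀ ⦃t₁ t₂ Ω : ℝ⦄, 0 ≤ t₁ → t₁ < t₂ → t₂ < T → (∀ t ∈ Icc t₁ t₂, ∀ x, ‖curl (u t) x‖ ≤ Ω) →
      ∫ x, ‖curl (u t₂) x‖ ^ 2 ≤ (∫ x, ‖curl (u t₁) x‖ ^ 2) * Real.exp (2 / Real.sqrt 3 * Ω * (t₂ - t₁)) := by
  intro t₁ t₂ Ω ht₁ h12 ht₂ hω
  set v : ℝ → EuclideanSpace ℝ (Fin 3) → EuclideanSpace ℝ (Fin 3) := fun s => u (s + t₁) with hv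
  have hd : 0 < t₂ - t₁ := sub_pos.2 h12
  have hS : IsClassicalNSSolutionOn (Icc 0 (t₂ - t₁)) ν 0 v (fun s => p (s + t₁)) :=
    (hcl.translate_Ico_zero ht₁).mono (Icc_subset_Ico_right (by linarith)) (uniqueDiffOn_Icc hd)
  have hB : HasBoundedSobolevNormsOn (Icc 0 (t₂ - t₁)) v := fun n => by
    obtain ⟨Cn, hCn⟩ := hreg t₂ ht₂ n
    exact ⟨Cn, fun s hs => hCn (s + t₁) ⟨by linarith [hs.1], by linarith [hs.2]⟩⟩
  have hΩ : ∀ s ∈ Icc 0 (t₂ - t₁), ∀ x, ‖curl (v s) x‖ ≤ Ω := fun s hs x =>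
    hω (s + t₁) ⟨by linarith [hs.1], by linarith [hs.2]⟩ x
  have h := integral_sq_norm_curl_le_mul_exp_sharp_of_norm_curl_le hν hd hS hB hΩ (t₂ - t₁) ⟨hd.le, le_rfl⟩
  simpa only [hv, sub_add_cancel, zero_add] using h

/-! ### The sharp floor -/

/-- **`log q ≤ (4/√3)C(q − 1)` for every `q > 1`** for a witness of the crux with `(T − t)‖curl u(t, x)‖ ≤ C` on
`[t₀, T) × ℝ³` (the ninth deposit's `log_le_of_slab` at `κ = 2/√3`).
[cite: Chae2005, Thm 2.2; RobinsonRodrigoSadowski2016, Thm 12.3; Leray1934, §20 (3.12)] -/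
theorem log_le_sharp_of_vorticityRate (hν : 0 < ν) (hT : 0 < T) (hmax : IsMaximalSmoothSolution ν 0 u p T)
    (hLH : IsLerayHopfOn T ν 0 (u 0) u) (hdec : HasRapidSpatialDecay (u 0)) (haxi : IsAxisymmetric (u 0))
    {C t₀ : ℝ} (ht₀ : 0 ≤ t₀) (ht₀T : t₀ < T) (hω : ∀ t ∈ Ico t₀ T, ∀ x, (T - t) * ‖curl (u t) x‖ ≤ C)
    {q : ℝ} (hq : 1 < q) : Real.log q ≤ 4 / Real.sqrt 3 * C * (q - 1) := by
  have hreg := hasBoundedSobolevNormsOn_before_of_lerayHopf_classical hν hT hmax.1 hLH hdec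
  have h := log_le_of_slab hν hT hmax hLH hdec haxi (slab_gronwall_sharp hν hmax.1 hreg) ht₀ ht₀T hω hq
  calc Real.log q ≤ 2 * (2 / Real.sqrt 3) * C * (q - 1) := h
    _ = 4 / Real.sqrt 3 * C * (q - 1) := by ring

/-- **CERTIFICATE-CLASS WITNESSES HAVE `C ≥ √3/4`.** For every `(ν, T, u, p)` of the certificate class
`CertifiedBlowupVorticityRateBlowup` and every `C` with `(T − t)‖curl u(t, x)‖ ≤ C` for all `x` and all `t` near `T⁻`:
`√3/4 ≤ C`. [cite: Chae2005, Thm 2.2; RobinsonRodrigoSadowski2016, Thm 12.3 (12.11)–(12.12); Leray1934, §20 (3.12)] -/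
theorem vorticityRate_witness_const_ge_sqrt3_div_four (hν : 0 < ν) (hT : 0 < T)
    (hmax : IsMaximalSmoothSolution ν 0 u p T) (hLH : IsLerayHopfOn T ν 0 (u 0) u)
    (hdec : HasRapidSpatialDecay (u 0)) (haxi : IsAxisymmetric (u 0)) {C : ℝ}
    (hrate : ∀ᶠ t in 𝓝[<] T, ∀ x : EuclideanSpace ℝ (Fin 3), (T - t) * ‖curl (u t) x‖ ≤ C) :
    Real.sqrt 3 / 4 ≤ C := by
  have hreg := hasBoundedSobolevNormsOn_before_of_lerayHopf_classical hν hT hmax.1 hLH hdec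
  have h := vorticityRate_witness_const_ge_of_slab hν hT hmax hLH hdec haxi two_div_sqrt_three_pos
    (slab_gronwall_sharp hν hmax.1 hreg) hrate
  rwa [inv_two_mul_two_div_sqrt_three] at h

/-- **`C > √3/4` STRICTLY** for every witness of the certificate class (the tenth deposit's
`vorticityRate_witness_const_gt_of_slab` at `κ = 2/√3`: at `C = √3/4` the vertex distance is bounded along every gauge
sequence, against the KNSS Type-II gauge sequence of deposit 7).
[cite: Chae2005, Thm 2.2; KochNadirashviliSereginSverak2009, Thms 6.1–6.2] -/
theorem vorticityRate_witness_const_gt_sqrt3_div_four (hν : 0 < ν) (hT : 0 < T)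
    (hmax : IsMaximalSmoothSolution ν 0 u p T) (hLH : IsLerayHopfOn T ν 0 (u 0) u)
    (hdec : HasRapidSpatialDecay (u 0)) (haxi : IsAxisymmetric (u 0)) {C : ℝ}
    (hrate : ∀ᶠ t in 𝓝[<] T, ∀ x : EuclideanSpace ℝ (Fin 3), (T - t) * ‖curl (u t) x‖ ≤ C) :
    Real.sqrt 3 / 4 < C := by
  have hreg := hasBoundedSobolevNormsOn_before_of_lerayHopf_classical hν hT hmax.1 hLH hdec
  have h := vorticityRate_witness_const_gt_of_slab hν hT hmax hLH hdec haxi two_div_sqrt_three_pos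
    (slab_gronwall_sharp hν hmax.1 hreg) hrate
  rwa [inv_two_mul_two_div_sqrt_three] at h

/-- **Equivalently: `limsup_{t → T⁻} (T − t)‖curl u(t)‖_∞ ≥ √3/4`** — for every witness of the certificate class (indeed
every maximal Leray–Hopf classical solution of finite lifespan from a rapidly decaying axisymmetric datum) and every
`C' < √3/4`, frequently as `t → T⁻` some point `x` has `C' < (T − t)‖curl u(t, x)‖`.
[cite: Chae2005, Thm 2.2; RobinsonRodrigoSadowski2016, Thm 12.3 (12.11)–(12.12); Leray1934, §20 (3.12)] -/
theorem vorticityRate_witness_frequently_gt_sharp (hν : 0 < ν) (hT : 0 < T)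
    (hmax : IsMaximalSmoothSolution ν 0 u p T) (hLH : IsLerayHopfOn T ν 0 (u 0) u)
    (hdec : HasRapidSpatialDecay (u 0)) (haxi : IsAxisymmetric (u 0)) {C' : ℝ} (hC' : C' < Real.sqrt 3 / 4) :
    ∃ᶠ t in 𝓝[<] T, ∃ x : EuclideanSpace ℝ (Fin 3), C' < (T - t) * ‖curl (u t) x‖ := by
  by_contra h
  rw [Filter.not_frequently] at h
  have h' : ∀ᶠ t in 𝓝[<] T, ∀ x : EuclideanSpace ℝ (Fin 3), (T - t) * ‖curl (u t) x‖ ≤ C' :=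
    h.mono fun t ht x => not_lt.1 fun hx => ht ⟨x, hx⟩
  exact (not_le.2 hC') (vorticityRate_witness_const_ge_sqrt3_div_four hν hT hmax hLH hdec haxi h')

/-- **THE KILL STATEMENT BELOW `√3/4`.** The text of crux #4 `CertifiedBlowupVorticityRateExclusion` with `∀ C`
restricted to `∀ C < √3/4` (verbatim otherwise): every maximal Leray–Hopf classical solution of finite lifespan `T > 0`
from a rapidly decaying axisymmetric datum, any `ν > 0`, has, for every `C < √3/4`, frequently near `T⁻` a point with
`C < (T − t)‖curl u(t, x)‖`. The certificate class with constant `< √3/4` is empty.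
[cite: Chae2005, Thm 2.2; RobinsonRodrigoSadowski2016, Thm 12.3 (12.11)–(12.12); Leray1934, §20 (3.12)] -/
theorem vorticityRateExclusion_below_sqrt3_div_four : ∀ ν : ℝ, 0 < ν → ∀ T : ℝ, 0 < T →
    ∀ (u : ℝ → EuclideanSpace ℝ (Fin 3) → EuclideanSpace ℝ (Fin 3)) (p : ℝ → EuclideanSpace ℝ (Fin 3) → ℝ),
    IsMaximalSmoothSolution ν 0 u p T → IsLerayHopfOn T ν 0 (u 0) u → HasRapidSpatialDecay (u 0) →
    IsAxisymmetric (u 0) → ∀ C : ℝ, C < Real.sqrt 3 / 4 →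
    ∃ᶠ t in 𝓝[<] T, ∃ x : EuclideanSpace ℝ (Fin 3), C < (T - t) * ‖curl (u t) x‖ :=
  fun _ hν _ hT _ _ hmax hLH hdec haxi _ hC =>
    vorticityRate_witness_frequently_gt_sharp hν hT hmax hLH hdec haxi hC

/-! ### The sharp modulation law -/

/-- **The sharp power law.** For a witness of the crux with `(T − t)‖curl u(t, x)‖ ≤ C` on `[t₀, T) × ℝ³`: for every
`t ∈ [t₀, T)`, `∫|curl u(t)|² ≤ (∫|curl u(t₀)|²) · ((T − t₀)/(T − t))^{(2/√3)C}`.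
[cite: Chae2005, Thm 2.2; RobinsonRodrigoSadowski2016, Thm 12.3 (12.12)] -/
theorem integral_sq_norm_curl_le_rpow_sharp (hν : 0 < ν) (hT : 0 < T) (hmax : IsMaximalSmoothSolution ν 0 u p T)
    (hLH : IsLerayHopfOn T ν 0 (u 0) u) (hdec : HasRapidSpatialDecay (u 0))
    {C t₀ : ℝ} (ht₀ : 0 ≤ t₀) (ht₀T : t₀ < T) (hω : ∀ t ∈ Ico t₀ T, ∀ x, (T - t) * ‖curl (u t) x‖ ≤ C)
    {t : ℝ} (ht : t ∈ Ico t₀ T) :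
    ∫ x, ‖curl (u t) x‖ ^ 2 ≤ (∫ x, ‖curl (u t₀) x‖ ^ 2) * ((T - t₀) / (T - t)) ^ (2 / Real.sqrt 3 * C) := by
  have hreg := hasBoundedSobolevNormsOn_before_of_lerayHopf_classical hν hT hmax.1 hLH hdec
  exact integral_sq_norm_curl_le_rpow_of_slab (slab_gronwall_sharp hν hmax.1 hreg) ht₀ ht₀T hω ht

/-- **CERTIFICATE-CLASS WITNESSES: THE VELOCITY RATE EXPONENT IS AT MOST `(1 + (2/√3)C)/3`.** For every `(ν, T, u, p)`
of the certificate class and every `C` with `(T − t)‖curl u(t, x)‖ ≤ C` near `T⁻`: `C > √3/4`, and there are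
`t₀ ∈ [0, T)` and `K ≥ 0` with `(T − t)^{1+(2/√3)C}‖u(t, x)‖³ ≤ K` for all `t ∈ [t₀, T)` and all `x`.
[cite: Chae2005, Thm 2.2; MajdaBertozziCUP2002, §4.1.3 (4.30); KochNadirashviliSereginSverak2009, Thms 6.1–6.2] -/
theorem vorticityRate_witness_velocity_exponent_sharp (hν : 0 < ν) (hT : 0 < T)
    (hmax : IsMaximalSmoothSolution ν 0 u p T) (hLH : IsLerayHopfOn T ν 0 (u 0) u)
    (hdec : HasRapidSpatialDecay (u 0)) (haxi : IsAxisymmetric (u 0)) {C : ℝ}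
    (hrate : ∀ᶠ t in 𝓝[<] T, ∀ x : EuclideanSpace ℝ (Fin 3), (T - t) * ‖curl (u t) x‖ ≤ C) :
    Real.sqrt 3 / 4 < C ∧ ∃ t₀ ∈ Ico 0 T, ∃ K : ℝ, 0 ≤ K ∧
      ∀ t ∈ Ico t₀ T, ∀ x : EuclideanSpace ℝ (Fin 3), (T - t) ^ (1 + 2 / Real.sqrt 3 * C) * ‖u t x‖ ^ 3 ≤ K := by
  have hreg := hasBoundedSobolevNormsOn_before_of_lerayHopf_classical hν hT hmax.1 hLH hdec
  have h := vorticityRate_witness_velocity_exponent_of_slab hν hT hmax hLH hdec haxi two_div_sqrt_three_pos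
    (slab_gronwall_sharp hν hmax.1 hreg) hrate
  rw [inv_two_mul_two_div_sqrt_three] at h
  exact h

end Summit.NavierStokesRegularity.NavierStokesRegularity.Theorems.CertifiedBlowupVorticityRateBlowup.SlabFloor

end
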